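import Mathlib
import HarnessLib
import Summits.NavierStokesRegularity.NavierStokesRegularity.Theses.PoloidalWindowDoor
import Summits.NavierStokesRegularity.NavierStokesRegularity.Theorems.PoloidalWindowDoorPoloidalWindowRigiditySharper
import Summits.NavierStokesRegularity.NavierStokesRegularity.Theorems.PoloidalWindowDoorPoloidalWindowRigidityK2OfLrcSpatial
import Summits.NavierStokesRegularity.NavierStokesRegularity.Theorems.PoloidalWindowDoorPoloidalWindowRigidityHorizontalFlatPast
import Summits.NavierStokesRegularity.NavierStokesRegularity.Theorems.PoloidalWindowDoorPoloidalWindowRigidityEntireGerm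
import Summits.NavierStokesRegularity.NavierStokesRegularity.Theorems.PoloidalWindowDoorPoloidalWindowRigidityTimeShearLiminf
import Summits.NavierStokesRegularity.NavierStokesRegularity.Theorems.PoloidalWindowDoorPoloidalWindowRigidityK2OfLrcSlope
import Summits.NavierStokesRegularity.NavierStokesRegularity.Theorems.PoloidalWindowDoorPoloidalWindowRigidityStubUntwisted
import Summits.NavierStokesRegularity.NavierStokesRegularity.Theorems.PoloidalWindowDoorPoloidalWindowRigidityHorizontalMean

/-!
# SKELETON `sparse_energy` (v1) — crux `PoloidalWindowRigidity` (K2, stmt-NavierStokesRegularity-19708), route `PoloidalWindowDoor`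
# (crux-strategist cstrat-19708 g11, 2026-08-28).  NS regularity is NOT proved by this file; it is a registered decomposition of ONE crux
# with three `sorry`-stubs (a class-level a-priori estimate proved on paper in the line card, its routine plane-mean corollary, one research residue) and a kernel-checked
# composition concluding the crux BY NAME (the composition below `twisting_of_sparseEnergy` is lrc_jet v5's chain verbatim).

THE LEVER (new on this crux; class-level, poloidality not used): **TYPE-I IN TIME ⇒ TYPE-I IN SPACE ON AVERAGE.**  For a profile of the
route's class (bounded ancient Oseen-mild, `|v(t,x)| ≤ C(−t)^{-1/2}`) the SCALE-INVARIANT ENERGY is bounded at EVERY interior scale, uniformly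
up to the apex:  `sup_{t<0, a, R>0} R⁻¹ ∫_{B_R(a)} |v(t,x)|² dx ≤ K(C)`  and  `R⁻¹ ∫_{-∞}^{t} ∫_{B_R(a)} |∇v|² ≤ K(C)`  (`stub_scaledEnergy`).
Proof on paper (line card §Stubs): the local energy identity has NO unsigned volume source — only fluxes; run it on balls `B_R(a)` at an
INTERIOR time `t₀ < 0` started at `s = −∞` (where `∫_{B_{2R}}|v(s)|² ≤ cC²R³/(−s) → 0`), bound the cubic flux by `(M(t)/R)·E(4R,t)`, the pressure
flux by a near-field (`L^{3/2}`, Calderón–Zygmund) / far-field (harmonic, oscillation `≲ R Σ_k (2^kR)^{-4} E(2^{k+1}R,t)`) split, the viscous flux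
by `min{R⁻² E(2R,t), M(t)³R²}`, and BOOTSTRAP in `R` with the time integral split at `−t ≈ C²R²`:  `E ≲ M²R³ → C³R²(−t)^{-1/2} → C⁴R log → K(C)·R`
(three explicit rounds; the exponent of `R` drops because `∫_{-∞}M³ dt < ∞` while `∫ M² dt` only ever meets bounds carrying `1/R`).
This is exactly the structural fact STRATEGY-CENSUS-g3 §0 recorded as MISSING from the class («the class as typed carries no local-energy /
Morrey bound at the apex … I do not see [a proof]: the local energy inequality integrates C³(−t)^{−3/2}») — the apex cylinders are never used;
interior cylinders reaching back to `−∞` are.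

CONSEQUENCES handed to the residue prover (line card §Frame facts): (a) every horizontal-translation-invariant MEAN of every quadratic quantity
vanishes on every plane (slabs of thickness `h`: disc means `≤ 2K/(πRh) + 2c₁C³(−t)^{-3/2}h → 0`); hence every xₕ-periodic / almost-periodic /
recurrent-hull scenario (the SHAPE of refuter1's K-47 `twistProfile` and K-49/K-50 columns, string_shells' pure-point hole (b″), N1/N3 modal
families) is excluded at CLASS level; (b) in the (TH) normal form the plane mean of (E) with `⟨w⟩ = 0` (div-free + BMO) and `⟨w²⟩ = 0` forces the
FREE PRESSURE DATUM to vanish, `β_z ≡ 0`: (E) becomes source-free, `(1−μ)(D_t w − Δw) = (μ_z/2)w² + (μ_t−μ_zz)w − 2μ_z w_z`, the Φ₂-identity keeps one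
unsigned coefficient, and the plane envelope `P = sup ψ` is a viscosity subsolution of the clean law `P_t + ∂_z[P²/(2(1−μ))] − P_zz ≤ 0`;
(c) the apex is a point where `(v,p)` is a SUITABLE WEAK SOLUTION with bounded scaled energies `A, E, C, D` at all scales (`C(r) ≤ 2CK`), so
ε-regularity (CKN / Tian–Xin in `A`), Albritton–Barker persistence of singularities under blow-up (tree fact `PersistenceOfSingularities`) and the
ESŠ backward-uniqueness route become available to a SECOND ZOOM of a class profile at its own apex (census g3 S⁺₃/D6 unblocked).
WHAT IT DOES NOT DO: Liouville for local-energy ancient solutions with bounded scaled energies is open (Seregin, Lecture Notes 2014, p. 127);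
`stub_scaledEnergy` alone cannot close the crux — the residue `stub_twistingSparse` is lrc_jet's `stub_twisting` on SPARSE, SOURCE-FREE profiles.

Composition: `PoloidalWindowRigidity` ⇐ (tree) `…Sharper.poloidalWindowRigidity_of_sliceSharpNonflatLiouville` ⇐ `sliceSharpNonflatLiouville_of_sparseEnergy`
⇐ (tree) `…K2OfLrcSpatial.nonflatLiouville_of_lrc_spatial` with `lrcSpatial_of_stubs` (`ndRegular`: pointwise twist dichotomy over the tree theorem
`…StubUntwisted.stub_untwisted` and `twisting_of_sparseEnergy := stub_twistingSparse ∘ (stub_scaledEnergy, stub_planeMeansVanish)`) and `tv_of_stubs` (tree).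
-/

-- the summit and its single sub-problem share the name (CONVENTIONS §1)
set_option linter.dupNamespace false

namespace Summit.NavierStokesRegularity.NavierStokesRegularity.Cruxes.PoloidalWindowRigidity.SparseEnergy

open Set Function MeasureTheory
open scoped RealInnerProductSpace InnerProductSpace ENNReal
open Literature.Analysis Literature.Analysis.FluidPDE
open Summit.NavierStokesRegularity.NavierStokesRegularity.Theorems.PoloidalWindowDoorPoloidalWindowRigiditySharper
open Summit.NavierStokesRegularity.NavierStokesRegularity.Theorems.PoloidalWindowDoorPoloidalWindowRigidityK2OfLrcSpatial
open Summit.NavierStokesRegularity.NavierStokesRegularity.Theorems.PoloidalWindowDoorPoloidalWindowRigidityHorizontalFlatPast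
open Summit.NavierStokesRegularity.NavierStokesRegularity.Theorems.PoloidalWindowDoorPoloidalWindowRigidityEntireGerm
open Summit.NavierStokesRegularity.NavierStokesRegularity.Theorems.PoloidalWindowDoorPoloidalWindowRigidityK2OfLrcSlope
open Summit.NavierStokesRegularity.NavierStokesRegularity.Theorems.TubeAlternative.AnalyticPropagation
open Summit.NavierStokesRegularity.NavierStokesRegularity.Theorems.PoloidalWindowDoorPoloidalWindowRigidityHorizontalMean

/-- **STUB S1 (`stub_scaledEnergy`) — TYPE-I IN TIME ⇒ BOUNDED SCALE-INVARIANT ENERGY AT EVERY INTERIOR SCALE (class-level a-priori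
estimate; PROVED ON PAPER in the line card; Lean size L).**  For a profile of the route's Type-I class (no poloidality needed) there is
`K ≥ 0` with, for every `t₀ < 0`, every centre `a` and every radius `R > 0`:
`∫_{B_R(a)} |v(t₀,x)|² dx ≤ K·R` and `∫_{t<t₀} ∫_{B_R(a)} ‖∇v(t,x)‖² dx dt ≤ K·R` (lower Lebesgue integrals, so no junk values).
Mechanism: local energy identity on `B_R(a) × (−∞, t₀]` started at `−∞`, near/far Calderón–Zygmund split of the Oseen pressure, and a
three-round bootstrap in `R` with the time integral split at `−t ≈ C²R²` (`R³ → R²(−t)^{-1/2} → R log → R`).  Nearest print: Seregin,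
Lecture Notes (2014) Prop. 3.11 / Prop. 6.20 (suitable weak solutions NEAR a Type-I point; here the abstract ancient class, interior
cylinders reaching `−∞`, uniform up to the apex).  Honours `poloidalWindowRigidity_false_without_mild` / `twisting_false_without_mild`:
mildness is used (energy identity, pressure representation), and the conclusion FAILS for the xₕ-periodic K-47 witness `twistProfile`
(energy in `B_R` grows like `R³`). -/
theorem stub_scaledEnergy :
    ∀ (C : ℝ) (v : ℝ → EuclideanSpace ℝ (Fin 3) → EuclideanSpace ℝ (Fin 3)),
      Literature.Analysis.FluidPDE.HasTypeITimeDecay C v →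
      ContinuousOn (Function.uncurry v) (Set.Iio (0 : ℝ) ×ˢ Set.univ) →
      (∀ s t : ℝ, s < t → t < 0 → ∀ x, v t x =
        Literature.Analysis.UnboundedOperators.heatExtension (v s) (t - s) x -
          Literature.Analysis.FluidPDE.oseenDuhamel 1 s v v t x) →
      (∀ t < 0, Literature.Analysis.FluidPDE.VectorCalculus.IsDivFree (v t)) →
      ∃ K : ℝ, 0 ≤ K ∧ ∀ t₀ : ℝ, t₀ < 0 → ∀ (a : EuclideanSpace ℝ (Fin 3)) (R : ℝ), 0 < R →
        (∫⁻ x in Metric.ball a R, ENNReal.ofReal (‖v t₀ x‖ ^ 2)) ≤ ENNReal.ofReal (K * R) ∧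
        (∫⁻ t in Set.Iio t₀, ∫⁻ x in Metric.ball a R, ENNReal.ofReal (‖fderiv ℝ (v t) x‖ ^ 2)) ≤ ENNReal.ofReal (K * R) := by
  sorry

/-- **STUB S3 (`stub_planeMeansVanish`) — SPARSE ENERGY ⇒ EVERY HORIZONTAL PLANE MEAN OF `|v|²` VANISHES, UNIFORMLY IN THE
PLANE (Lean size M; routine).**  In the crux's native currency of horizontal bump means `…HorizontalMean.hmean` (K2-p2): if the
scale-invariant energy of a Type-I class profile is bounded by `K·R` on every ball, then for every bump `φ`, every `t < 0` and every
`ε > 0` there is `R₀` with `hmean φ c R z (|v(t,·)|²) ≤ ε` for all `R ≥ R₀`, all centres `c` and heights `z`.  Mechanism: average the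
plane mean over a slab of thickness `2h` (a subset of a ball of radius `2R`, energy `≤ 2KR`, so slab average `≤ c_φ K/(hR)`), and control
the deviation from the slab average by the class gradient rate `‖∇v(t)‖_∞ ≤ C₁/(−t)` (`…ClassRate.exists_fderiv_rate_of_class`):
`hmean ≤ c_φ K/(hR) + 2 C C₁ (−t)^{-3/2} h`, then `h = R^{-1/2}`.  Consequence used downstream (line card): by Cauchy–Schwarz every
horizontal-translation-invariant mean of `v`, `|v|²`, `w ∂_z w`, … vanishes on every plane, which in the (TH) normal form
`…TwistingTHLocalDatum.exists_localTHDatum` forces the pressure datum `A ≡ 0`. -/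
theorem stub_planeMeansVanish :
    ∀ (C : ℝ) (v : ℝ → EuclideanSpace ℝ (Fin 3) → EuclideanSpace ℝ (Fin 3)),
      Literature.Analysis.FluidPDE.HasTypeITimeDecay C v →
      ContinuousOn (Function.uncurry v) (Set.Iio (0 : ℝ) ×ˢ Set.univ) →
      (∀ s t : ℝ, s < t → t < 0 → ∀ x, v t x =
        Literature.Analysis.UnboundedOperators.heatExtension (v s) (t - s) x -
          Literature.Analysis.FluidPDE.oseenDuhamel 1 s v v t x) →
      ∀ K : ℝ, 0 ≤ K →
        (∀ t₀ : ℝ, t₀ < 0 → ∀ (a : EuclideanSpace ℝ (Fin 3)) (R : ℝ), 0 < R →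
          (∫⁻ x in Metric.ball a R, ENNReal.ofReal (‖v t₀ x‖ ^ 2)) ≤ ENNReal.ofReal (K * R) ∧
          (∫⁻ t in Set.Iio t₀, ∫⁻ x in Metric.ball a R, ENNReal.ofReal (‖fderiv ℝ (v t) x‖ ^ 2)) ≤ ENNReal.ofReal (K * R)) →
        ∀ (φ : ContDiffBump (0 : EuclideanSpace ℝ (Fin 2))) (t : ℝ), t < 0 → ∀ ε : ℝ, 0 < ε →
          ∃ R₀ : ℝ, 0 < R₀ ∧ ∀ R : ℝ, R₀ ≤ R → ∀ (c : EuclideanSpace ℝ (Fin 3)) (z : ℝ),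
            hmean φ c R z (fun x => ‖v t x‖ ^ 2) ≤ ε := by
  sorry

/-- **STUB S2 (`stub_twistingSparse`) — THE TWISTING RESIDUE ON SPARSE PROFILES (research).**  lrc_jet v5's `stub_twisting` VERBATIM
(class; poloidal along `e₃`; a nonempty open space–time set `W` on which the profile is non-degenerate, carries the v3 pin and TWISTS) with
TWO extra class hypotheses, delivered by `stub_scaledEnergy` and `stub_planeMeansVanish`: the scale-invariant energy and dissipation are
bounded by `K·R` on every ball at every interior time, and every horizontal plane mean of `|v(t)|²` vanishes uniformly in the plane.  Frame facts for the prover (line card): plane means of all quadratic quantities vanish (rate `R^{-1/2}`), hence in the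
(TH) gauge the pressure datum `β_z ≡ 0` and (E) is source-free; every xₕ-recurrent scenario is already excluded; the apex carries a suitable
weak solution with bounded `A, E, C, D`, so ε-regularity in `A`, persistence of singularities under a second apex zoom and backward
uniqueness are available.  Honours `twisting_false_without_mild` (mild kept verbatim; the sparse hypothesis itself fails for `twistProfile`)
and `localTHEmpty_false_without_slopeGradient` (pin and twist kept verbatim).  Why it might be as hard as the crux: Liouville for
local-energy ancient solutions with bounded scaled energies is Seregin's open formulation of Type-I exclusion; the bet is that SPARSE +
SOURCE-FREE + the rigid (TH)/THICK kinematics is decidable where bounded + free datum was not. -/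
theorem stub_twistingSparse :
    ∀ (C : ℝ) (v : ℝ → EuclideanSpace ℝ (Fin 3) → EuclideanSpace ℝ (Fin 3)),
      Literature.Analysis.FluidPDE.HasTypeITimeDecay C v →
      ContinuousOn (Function.uncurry v) (Set.Iio (0 : ℝ) ×ˢ Set.univ) →
      (∀ s t : ℝ, s < t → t < 0 → ∀ x, v t x =
        Literature.Analysis.UnboundedOperators.heatExtension (v s) (t - s) x -
          Literature.Analysis.FluidPDE.oseenDuhamel 1 s v v t x) →
      (∀ t < 0, Literature.Analysis.FluidPDE.VectorCalculus.IsDivFree (v t)) →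
      (∀ s < 0, ∀ y, ⟪Literature.Analysis.FluidPDE.curl (v s) y, EuclideanSpace.single 2 1⟫_ℝ = 0) →
      ∀ K : ℝ, 0 ≤ K →
        (∀ t₀ : ℝ, t₀ < 0 → ∀ (a : EuclideanSpace ℝ (Fin 3)) (R : ℝ), 0 < R →
          (∫⁻ x in Metric.ball a R, ENNReal.ofReal (‖v t₀ x‖ ^ 2)) ≤ ENNReal.ofReal (K * R) ∧
          (∫⁻ t in Set.Iio t₀, ∫⁻ x in Metric.ball a R, ENNReal.ofReal (‖fderiv ℝ (v t) x‖ ^ 2)) ≤ ENNReal.ofReal (K * R)) →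
        (∀ (φ : ContDiffBump (0 : EuclideanSpace ℝ (Fin 2))) (t : ℝ), t < 0 → ∀ ε : ℝ, 0 < ε →
          ∃ R₀ : ℝ, 0 < R₀ ∧ ∀ R : ℝ, R₀ ≤ R → ∀ (c : EuclideanSpace ℝ (Fin 3)) (z : ℝ),
            hmean φ c R z (fun x => ‖v t x‖ ^ 2) ≤ ε) →
      ∀ W : Set (ℝ × EuclideanSpace ℝ (Fin 3)), IsOpen W → W.Nonempty → W ⊆ Set.Iio (0 : ℝ) ×ˢ Set.univ →
        (∀ z ∈ W, Literature.Analysis.FluidPDE.curl (v z.1) z.2 ≠ 0 ∧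
          (fderiv ℝ (v z.1) z.2 (EuclideanSpace.single 0 1) 2 ≠ 0 ∨ fderiv ℝ (v z.1) z.2 (EuclideanSpace.single 1 1) 2 ≠ 0) ∧
          (fderiv ℝ (v z.1) z.2 (EuclideanSpace.single 2 1) 0 ≠ 0 ∨ fderiv ℝ (v z.1) z.2 (EuclideanSpace.single 2 1) 1 ≠ 0)) →
        (∀ m : ℝ → ℝ, ∀ W₁ : Set (ℝ × EuclideanSpace ℝ (Fin 3)), W₁ ⊆ W → IsOpen W₁ → W₁.Nonempty →
          ∃ z ∈ W₁, ∃ b : Fin 3, b ≠ 2 ∧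
            fderiv ℝ (v z.1) z.2 (EuclideanSpace.single 2 1) b ≠
              m z.1 * fderiv ℝ (v z.1) z.2 (EuclideanSpace.single b 1) 2) →
        (∀ z ∈ W,
          fderiv ℝ (fun x => fderiv ℝ (v z.1) x (EuclideanSpace.single 2 1) 2) z.2 (EuclideanSpace.single 0 1) *
              fderiv ℝ (v z.1) z.2 (EuclideanSpace.single 1 1) 2 -
            fderiv ℝ (fun x => fderiv ℝ (v z.1) x (EuclideanSpace.single 2 1) 2) z.2 (EuclideanSpace.single 1 1) *
              fderiv ℝ (v z.1) z.2 (EuclideanSpace.single 0 1) 2 ≠ 0) →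
        ¬ Literature.Analysis.FluidPDE.IsBackwardSingularPoint v 0 := by
  sorry

/-- **lrc_jet v5's `stub_twisting`, PROVED from the three stubs** (`stub_twistingSparse ∘ (stub_scaledEnergy, stub_planeMeansVanish)`). -/
theorem twisting_of_sparseEnergy :
    ∀ (C : ℝ) (v : ℝ → EuclideanSpace ℝ (Fin 3) → EuclideanSpace ℝ (Fin 3)),
      Literature.Analysis.FluidPDE.HasTypeITimeDecay C v →
      ContinuousOn (Function.uncurry v) (Set.Iio (0 : ℝ) ×ˢ Set.univ) →
      (∀ s t : ℝ, s < t → t < 0 → ∀ x, v t x =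
        Literature.Analysis.UnboundedOperators.heatExtension (v s) (t - s) x -
          Literature.Analysis.FluidPDE.oseenDuhamel 1 s v v t x) →
      (∀ t < 0, Literature.Analysis.FluidPDE.VectorCalculus.IsDivFree (v t)) →
      (∀ s < 0, ∀ y, ⟪Literature.Analysis.FluidPDE.curl (v s) y, EuclideanSpace.single 2 1⟫_ℝ = 0) →
      ∀ W : Set (ℝ × EuclideanSpace ℝ (Fin 3)), IsOpen W → W.Nonempty → W ⊆ Set.Iio (0 : ℝ) ×ˢ Set.univ →
        (∀ z ∈ W, Literature.Analysis.FluidPDE.curl (v z.1) z.2 ≠ 0 ∧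
          (fderiv ℝ (v z.1) z.2 (EuclideanSpace.single 0 1) 2 ≠ 0 ∨ fderiv ℝ (v z.1) z.2 (EuclideanSpace.single 1 1) 2 ≠ 0) ∧
          (fderiv ℝ (v z.1) z.2 (EuclideanSpace.single 2 1) 0 ≠ 0 ∨ fderiv ℝ (v z.1) z.2 (EuclideanSpace.single 2 1) 1 ≠ 0)) →
        (∀ m : ℝ → ℝ, ∀ W₁ : Set (ℝ × EuclideanSpace ℝ (Fin 3)), W₁ ⊆ W → IsOpen W₁ → W₁.Nonempty →
          ∃ z ∈ W₁, ∃ b : Fin 3, b ≠ 2 ∧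
            fderiv ℝ (v z.1) z.2 (EuclideanSpace.single 2 1) b ≠
              m z.1 * fderiv ℝ (v z.1) z.2 (EuclideanSpace.single b 1) 2) →
        (∀ z ∈ W,
          fderiv ℝ (fun x => fderiv ℝ (v z.1) x (EuclideanSpace.single 2 1) 2) z.2 (EuclideanSpace.single 0 1) *
              fderiv ℝ (v z.1) z.2 (EuclideanSpace.single 1 1) 2 -
            fderiv ℝ (fun x => fderiv ℝ (v z.1) x (EuclideanSpace.single 2 1) 2) z.2 (EuclideanSpace.single 1 1) *
              fderiv ℝ (v z.1) z.2 (EuclideanSpace.single 0 1) 2 ≠ 0) →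
        ¬ Literature.Analysis.FluidPDE.IsBackwardSingularPoint v 0 := by
  intro C v hrate hcont hmild hdiv hpol W hW hWne hWs hnd hpin htw
  obtain ⟨K, hK0, hK⟩ := stub_scaledEnergy C v hrate hcont hmild hdiv
  have hpm := stub_planeMeansVanish C v hrate hcont hmild K hK0 hK
  exact stub_twistingSparse C v hrate hcont hmild hdiv hpol K hK0 hK hpm W hW hWne hWs hnd hpin htw

/-- **NON-DEGENERATE + v3 PIN ⇒ regular** — lrc_jet v5's pointwise twist dichotomy, over the TREE theorem `…StubUntwisted.stub_untwisted`
(untwisted branch, p561151) and `twisting_of_sparseEnergy` (twisting branch).  The twist bracket is jointly continuous on the slab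
(`…K2OfLrcSlope.analyticOnNhd_uncurry_fderiv_entry`, `…AnalyticPropagation.analyticOnNhd_uncurry_fderiv_slice_apply`). -/
theorem ndRegular :
    ∀ (C : ℝ) (v : ℝ → EuclideanSpace ℝ (Fin 3) → EuclideanSpace ℝ (Fin 3)),
      Literature.Analysis.FluidPDE.HasTypeITimeDecay C v →
      ContinuousOn (Function.uncurry v) (Set.Iio (0 : ℝ) ×ˢ Set.univ) →
      (∀ s t : ℝ, s < t → t < 0 → ∀ x, v t x =
        Literature.Analysis.UnboundedOperators.heatExtension (v s) (t - s) x -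
          Literature.Analysis.FluidPDE.oseenDuhamel 1 s v v t x) →
      (∀ t < 0, Literature.Analysis.FluidPDE.VectorCalculus.IsDivFree (v t)) →
      (∀ s < 0, ∀ y, ⟪Literature.Analysis.FluidPDE.curl (v s) y, EuclideanSpace.single 2 1⟫_ℝ = 0) →
      ∀ W : Set (ℝ × EuclideanSpace ℝ (Fin 3)), IsOpen W → W.Nonempty → W ⊆ Set.Iio (0 : ℝ) ×ˢ Set.univ →
        (∀ z ∈ W, Literature.Analysis.FluidPDE.curl (v z.1) z.2 ≠ 0 ∧
          (fderiv ℝ (v z.1) z.2 (EuclideanSpace.single 0 1) 2 ≠ 0 ∨ fderiv ℝ (v z.1) z.2 (EuclideanSpace.single 1 1) 2 ≠ 0) ∧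
          (fderiv ℝ (v z.1) z.2 (EuclideanSpace.single 2 1) 0 ≠ 0 ∨ fderiv ℝ (v z.1) z.2 (EuclideanSpace.single 2 1) 1 ≠ 0)) →
        (∀ m : ℝ → ℝ, ∀ W₁ : Set (ℝ × EuclideanSpace ℝ (Fin 3)), W₁ ⊆ W → IsOpen W₁ → W₁.Nonempty →
          ∃ z ∈ W₁, ∃ b : Fin 3, b ≠ 2 ∧
            fderiv ℝ (v z.1) z.2 (EuclideanSpace.single 2 1) b ≠
              m z.1 * fderiv ℝ (v z.1) z.2 (EuclideanSpace.single b 1) 2) →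
        ¬ Literature.Analysis.FluidPDE.IsBackwardSingularPoint v 0 := by
  intro C v hrate hcont hmild hdiv hpol W hW hWne hWs hnd hpin
  -- the twist bracket as a function on space–time
  set T : ℝ × EuclideanSpace ℝ (Fin 3) → ℝ := fun z =>
    fderiv ℝ (fun x => fderiv ℝ (v z.1) x (EuclideanSpace.single 2 1) 2) z.2 (EuclideanSpace.single 0 1) *
              fderiv ℝ (v z.1) z.2 (EuclideanSpace.single 1 1) 2 -
            fderiv ℝ (fun x => fderiv ℝ (v z.1) x (EuclideanSpace.single 2 1) 2) z.2 (EuclideanSpace.single 1 1) *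
              fderiv ℝ (v z.1) z.2 (EuclideanSpace.single 0 1) 2 with hT
  by_cases htw : ∃ z ∈ W, T z ≠ 0
  · -- TWISTING somewhere: restrict to the open set where `T ≠ 0`
    obtain ⟨z₀, hz₀W, hz₀⟩ := htw
    have hslab : IsOpen (Set.Iio (0 : ℝ) ×ˢ (Set.univ : Set (EuclideanSpace ℝ (Fin 3)))) :=
      isOpen_Iio.prod isOpen_univ
    have hD : ∀ j i : Fin 3, ContinuousOn
        (fun z : ℝ × EuclideanSpace ℝ (Fin 3) => fderiv ℝ (v z.1) z.2 (EuclideanSpace.single j 1) i)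
        (Set.Iio (0 : ℝ) ×ˢ Set.univ) := fun j i => continuousOn_fderiv_entry hrate hcont hmild j i
    have hD2 : ∀ b : Fin 3, ContinuousOn
        (fun z : ℝ × EuclideanSpace ℝ (Fin 3) =>
          fderiv ℝ (fun x => fderiv ℝ (v z.1) x (EuclideanSpace.single 2 1) 2) z.2 (EuclideanSpace.single b 1))
        (Set.Iio (0 : ℝ) ×ˢ Set.univ) := by
      intro b
      have h22 := analyticOnNhd_uncurry_fderiv_entry hrate hcont hmild 2 2
      have h := analyticOnNhd_uncurry_fderiv_slice_apply (w := fun s y => fderiv ℝ (v s) y (EuclideanSpace.single 2 1) 2)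
        h22 isOpen_Iio (v := fun _ _ => EuclideanSpace.single b 1) analyticOnNhd_const
      exact h.continuousOn
    have hTc : ContinuousOn T (Set.Iio (0 : ℝ) ×ˢ Set.univ) := by
      rw [hT]
      exact ((hD2 0).mul (hD 1 2)).sub ((hD2 1).mul (hD 0 2))
    have hO : IsOpen ((Set.Iio (0 : ℝ) ×ˢ Set.univ) ∩ T ⁻¹' {0}ᶜ) :=
      hTc.isOpen_inter_preimage hslab isOpen_compl_singleton
    set W₃ : Set (ℝ × EuclideanSpace ℝ (Fin 3)) := W ∩ ((Set.Iio (0 : ℝ) ×ˢ Set.univ) ∩ T ⁻¹' {0}ᶜ) with hW₃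
    have hW₃o : IsOpen W₃ := hW.inter hO
    have hW₃W : W₃ ⊆ W := Set.inter_subset_left
    have hW₃ne : W₃.Nonempty := ⟨z₀, hz₀W, hWs hz₀W, hz₀⟩
    refine twisting_of_sparseEnergy C v hrate hcont hmild hdiv hpol W₃ hW₃o hW₃ne (hW₃W.trans hWs)
      (fun z hz => hnd z (hW₃W hz)) (fun m W₁ hW₁ hW₁o hW₁ne => hpin m W₁ (hW₁.trans hW₃W) hW₁o hW₁ne) ?_
    intro z hz
    exact hz.2.2
  · -- UNTWISTED on all of `W`: the tree theorem (lead g6, p561151)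
    push Not at htw
    exact Summit.NavierStokesRegularity.NavierStokesRegularity.Theorems.PoloidalWindowDoorPoloidalWindowRigidityStubUntwisted.stub_untwisted
      C v hrate hcont hmild hdiv hpol W hW hWne hWs hnd htw

/-- **LRC″ with spatial pins, UNDER THE SINGULARITY ASSUMPTION** (proved, as in lrc_jet v5): vacuous by `ndRegular`. -/
theorem lrcSpatial_of_stubs :
    ∀ (C : ℝ) (v : ℝ → EuclideanSpace ℝ (Fin 3) → EuclideanSpace ℝ (Fin 3)),
      Literature.Analysis.FluidPDE.HasTypeITimeDecay C v →
      ContinuousOn (Function.uncurry v) (Set.Iio (0 : ℝ) ×ˢ Set.univ) →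
      (∀ s t : ℝ, s < t → t < 0 → ∀ x, v t x =
        Literature.Analysis.UnboundedOperators.heatExtension (v s) (t - s) x -
          Literature.Analysis.FluidPDE.oseenDuhamel 1 s v v t x) →
      (∀ t < 0, Literature.Analysis.FluidPDE.VectorCalculus.IsDivFree (v t)) →
      (∀ s < 0, ∀ y, ⟪Literature.Analysis.FluidPDE.curl (v s) y, EuclideanSpace.single 2 1⟫_ℝ = 0) →
      Literature.Analysis.FluidPDE.IsBackwardSingularPoint v 0 →
      ∀ W : Set (ℝ × EuclideanSpace ℝ (Fin 3)), IsOpen W → W.Nonempty → W ⊆ Set.Iio (0 : ℝ) ×ˢ Set.univ →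
        (∀ z ∈ W, Literature.Analysis.FluidPDE.curl (v z.1) z.2 ≠ 0 ∧
          (fderiv ℝ (v z.1) z.2 (EuclideanSpace.single 0 1) 2 ≠ 0 ∨ fderiv ℝ (v z.1) z.2 (EuclideanSpace.single 1 1) 2 ≠ 0) ∧
          (fderiv ℝ (v z.1) z.2 (EuclideanSpace.single 2 1) 0 ≠ 0 ∨ fderiv ℝ (v z.1) z.2 (EuclideanSpace.single 2 1) 1 ≠ 0)) →
        (∀ m : ℝ → ℝ, ∀ W₁ : Set (ℝ × EuclideanSpace ℝ (Fin 3)), W₁ ⊆ W → IsOpen W₁ → W₁.Nonempty →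
          ∃ z ∈ W₁, ∃ b : Fin 3, b ≠ 2 ∧
            fderiv ℝ (v z.1) z.2 (EuclideanSpace.single 2 1) b ≠
              m z.1 * fderiv ℝ (v z.1) z.2 (EuclideanSpace.single b 1) 2) →
        ∃ s : ℝ, s < 0 ∧ ∃ U : Set (EuclideanSpace ℝ (Fin 3)), IsOpen U ∧ U.Nonempty ∧
          ((∃ e : EuclideanSpace ℝ (Fin 3), e ≠ 0 ∧ ∀ y ∈ U, fderiv ℝ (Literature.Analysis.FluidPDE.curl (v s)) y e = 0) ∨
           (∃ c : EuclideanSpace ℝ (Fin 3), ∀ y ∈ U,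
              Literature.Analysis.FluidPDE.rotGen (Literature.Analysis.FluidPDE.curl (v s) y) =
                fderiv ℝ (Literature.Analysis.FluidPDE.curl (v s)) y (Literature.Analysis.FluidPDE.rotGen (y - c)))) := by
  intro C v hrate hcont hmild hdiv hpol hsing W hW hWne hWs hnd hpin
  exact absurd hsing (ndRegular C v hrate hcont hmild hdiv hpol W hW hWne hWs hnd hpin)

/-- **(TV) from the two halves (proved, as in lrc_jet v5)**: the bounded-along-a-sequence half is the tree theorem
`…TimeShearLiminf.stub_tvLiminf` (p525351); the growth branch is `…HorizontalFlatPast.nonflatLiouville_of_timeShear_unbounded`. -/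
theorem tv_of_stubs :
    ∀ (C : ℝ) (v : ℝ → EuclideanSpace ℝ (Fin 3) → EuclideanSpace ℝ (Fin 3)),
      Literature.Analysis.FluidPDE.HasTypeITimeDecay C v →
      ContinuousOn (Function.uncurry v) (Set.Iio (0 : ℝ) ×ˢ Set.univ) →
      (∀ s t : ℝ, s < t → t < 0 → ∀ x, v t x =
        Literature.Analysis.UnboundedOperators.heatExtension (v s) (t - s) x -
          Literature.Analysis.FluidPDE.oseenDuhamel 1 s v v t x) →
      (∀ t < 0, Literature.Analysis.FluidPDE.VectorCalculus.IsDivFree (v t)) →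
      (∀ s < 0, ∀ y, ⟪Literature.Analysis.FluidPDE.curl (v s) y, EuclideanSpace.single 2 1⟫_ℝ = 0) →
      ∀ μ : ℝ → ℝ, (∀ s < 0, μ s < 0) → (∀ s < 0, AnalyticAt ℝ μ s) →
        (∃ s₁ s₂ : ℝ, s₁ < 0 ∧ s₂ < 0 ∧ μ s₁ ≠ μ s₂) →
        (∀ s < 0, ∀ y, ∀ b : Fin 3, b ≠ 2 →
          fderiv ℝ (v s) y (EuclideanSpace.single 2 1) b = μ s * fderiv ℝ (v s) y (EuclideanSpace.single b 1) 2) →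
        ¬ Literature.Analysis.FluidPDE.IsBackwardSingularPoint v 0 := by
  intro C v hrate hcont hmild hdiv hpol μ hneg han hnc hslope
  by_cases hB : ∃ M : ℝ, ∀ T : ℝ, ∃ τ < T, -M ≤ μ τ
  · exact Summit.NavierStokesRegularity.NavierStokesRegularity.Theorems.PoloidalWindowDoorPoloidalWindowRigidityTimeShearLiminf.stub_tvLiminf
      C v hrate hcont hmild hdiv hpol μ hneg han hnc hslope hB
  · push Not at hB
    refine nonflatLiouville_of_timeShear_unbounded hrate hcont hmild hdiv hpol hslope fun M => ?_
    obtain ⟨T, hT⟩ := hB M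
    refine ⟨T, fun τ hτ => ?_⟩
    have h1 : μ τ < -M := hT τ hτ
    have h2 : M < -μ τ := by linarith
    exact h2.le.trans (neg_le_abs (μ τ))

/-- **The slice-sharp residue from the stubs** (proved, as in lrc_jet v5): class + poloidal ⇒ not backward-singular, by contradiction with
K2-p3 g4's `nonflatLiouville_of_lrc_spatial`, `lrcSpatial_of_stubs` and `tv_of_stubs`. -/
theorem sliceSharpNonflatLiouville_of_sparseEnergy :
    ∀ (C : ℝ) (v : ℝ → EuclideanSpace ℝ (Fin 3) → EuclideanSpace ℝ (Fin 3)),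
      Literature.Analysis.FluidPDE.HasTypeITimeDecay C v →
      ContinuousOn (Function.uncurry v) (Set.Iio (0 : ℝ) ×ˢ Set.univ) →
      (∀ s t : ℝ, s < t → t < 0 → ∀ x, v t x =
        Literature.Analysis.UnboundedOperators.heatExtension (v s) (t - s) x -
          Literature.Analysis.FluidPDE.oseenDuhamel 1 s v v t x) →
      (∀ t < 0, Literature.Analysis.FluidPDE.VectorCalculus.IsDivFree (v t)) →
      (∀ s < 0, ∀ y, ⟪Literature.Analysis.FluidPDE.curl (v s) y, EuclideanSpace.single 2 1⟫_ℝ = 0) →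
      (∀ s < 0, ∀ y, ⟪fderiv ℝ (v s) y (Literature.Analysis.FluidPDE.curl (v s) y), EuclideanSpace.single 2 1⟫_ℝ = 0) →
      (∀ s < 0, ∀ b : EuclideanSpace ℝ (Fin 3), b ≠ 0 → ∃ y,
        Literature.Analysis.FluidPDE.cross (Literature.Analysis.FluidPDE.curl (v s) y) b ≠ 0) →
      (∀ s < 0, ∃ y, fderiv ℝ (v s) y (EuclideanSpace.single 2 1) 0 ≠ 0 ∨
        fderiv ℝ (v s) y (EuclideanSpace.single 2 1) 1 ≠ 0) →
      (∀ s < 0, ∀ a : EuclideanSpace ℝ (Fin 3), a ≠ 0 → ⟪a, EuclideanSpace.single 2 1⟫_ℝ = 0 →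
        ∃ y, ⟪fderiv ℝ (v s) y a, EuclideanSpace.single 2 1⟫_ℝ ≠ 0) →
      (∀ s < 0, ∀ e : EuclideanSpace ℝ (Fin 3), e ≠ 0 → ∃ (y : EuclideanSpace ℝ (Fin 3)) (l : ℝ), v s (y + l • e) ≠ v s y) →
      (∀ s < 0, ∀ (L : EuclideanSpace ℝ (Fin 3) ≃ₗᵢ[ℝ] EuclideanSpace ℝ (Fin 3)) (c : EuclideanSpace ℝ (Fin 3)),
        ¬ Literature.Analysis.FluidPDE.IsAxisymmetric (fun y => L.symm (v s (L y + c)))) →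
      (∃ lam : ℝ, 0 < lam ∧ ∃ s < 0, ∃ y, lam • v (lam ^ 2 * s) (lam • y) ≠ v s y) →
      ¬ Literature.Analysis.FluidPDE.IsBackwardSingularPoint v 0 := by
  intro C v hrate hcont hmild hdiv hpol _ _ _ _ _ _ _ hsing
  exact nonflatLiouville_of_lrc_spatial hrate hcont hmild hdiv hpol
    (lrcSpatial_of_stubs C v hrate hcont hmild hdiv hpol hsing) (tv_of_stubs C v hrate hcont hmild hdiv hpol) hsing

/-- COMPOSITION (proved): the crux BY NAME from the three stubs `stub_scaledEnergy`, `stub_planeMeansVanish`, `stub_twistingSparse`, via the landed reduction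
`…Sharper.poloidalWindowRigidity_of_sliceSharpNonflatLiouville`. -/
theorem PoloidalWindowRigidity_of_sparseEnergy :
    Summit.NavierStokesRegularity.NavierStokesRegularity.Theses.PoloidalWindowDoor.PoloidalWindowRigidity :=
  poloidalWindowRigidity_of_sliceSharpNonflatLiouville sliceSharpNonflatLiouville_of_sparseEnergy

end Summit.NavierStokesRegularity.NavierStokesRegularity.Cruxes.PoloidalWindowRigidity.SparseEnergy
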